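import Literature.NumberTheory.ComplexMultiplication.EllipticUnits.ImaginaryQuadraticMainConjectureLayerDualityPairing
import Literature.NumberTheory.ComplexMultiplication.EllipticUnits.CoinducedPairingAdjointSums
import HarnessLib

/-!
# NATURALITY of the layer Poitou–Tate pairing `Ш²_S(K̃_n, μ_{p^k} ⊗ θ′) × Ш¹_S(K̃_n, (ℤ/p^k)(θ)) → ℚ/ℤ`:
# corestriction ⊣ restriction, reduction ⊣ inclusion, `conj_γ ⊣ conj_{γ⁻¹}` — the fields `pair_cores`, `pair_red`,
# `pair_conj` of the ROW 1 socket `JohnsonLeungKings2011.LayerDuality` (Milne I §4 p. 65; JLK 2011 Lemma 5.8)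

Topic `Literature/NumberTheory/ComplexMultiplication/EllipticUnits` (grouping sub-namespace `JohnsonLeungKings2011.ClassGroupRow`).
Cell `bsd-print-cf2`, width seat `bsd-line-cf2c-w8` g8, plug (π1) of ROW 1 of stub (Q).  THEOREMS ONLY (no definition, no
named fact, no instance, no `sorry`).  Everything is read off clause (N_V) of the tree's layer Poitou–Tate fact
(`PoitouTateShaRestrictedLayers.exists_shaRestricted_pairing_coind_of_natural_at`, seat g7) at the three adjoint pairs of
module maps (`CoinducedPairingAdjointSums`), transported to the carrier's currency by the Shapiro dictionary
(`transport_coindFinSum_eq_relCores` / `transport_coindFinMap_eq_levelRed` / `transport_rTransHom_eq_levelConj_two` on the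
`H²` side, `layerShapiroEquiv_transport_coindFinRes` / `_coindFinMap` / `_rTransHom_one` on the `H¹` side, seats cf2c-w3 g9/g10).

* §1 `coe_eTwo_symm_eq`, `coe_eOne_symm_eq` — identification of `e⁻¹` of a structure-mapped class (injectivity of the transport);
* §2 `pair_cores` — `⟨cor y, z⟩_n = ⟨y, res z⟩_{n+1}`;
* §3 `pair_red` — `⟨red y, z⟩_k = ⟨y, incl z⟩_{k+1}`;
* §4 `pair_conj` — `⟨conj_γ y, z⟩ = ⟨y, conj_{γ⁻¹} z⟩`.

HONEST FRAMING: conditional on the displayed base-field Poitou–Tate fact `h` (a hypothesis, as in `…LayerDualityPairing`); no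
main conjecture, no BSD is proved here; no summit statement is proved by this seat.

## References
* J. S. Milne, *Arithmetic Duality Theorems* (2006), I §4 p. 65 (naturality), I Thm. 4.10 (a). [MilneADT2006]
* J. Johnson-Leung, G. Kings, *On the equivariant main conjecture for imaginary quadratic fields* (2011), §5.4 Lemma 5.8. [JohnsonLeungKings2011]
* J. Neukirch, A. Schmidt, K. Wingberg (2008), I §5 Prop. (1.5.3)(iv), I §6 (1.6.4)–(1.6.5). [NeukirchSchmidtWingberg2008]
* J.-P. Serre, *Local Fields* (1979), VII §5. [SerreLocalFields1979]
-/

noncomputable section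

open scoped NumberField
open CategoryTheory Field IsDedekindDomain
open Literature.NumberTheory.GaloisRepresentations
open Literature.NumberTheory.GaloisRepresentations.DiscreteGaloisModule
open Literature.NumberTheory.GaloisCohomology Literature.NumberTheory.GaloisCohomology.ShaLayer
open Literature.NumberTheory.EllipticCurves Literature.NumberTheory.EllipticCurves.KellerYin2024

namespace Literature.NumberTheory.ComplexMultiplication.EllipticUnits.JohnsonLeungKings2011.ClassGroupRow

variable {K : Type} [Field K] [NumberField K] (p : ℕ) [Fact p.Prime]
  (κ₁ κ₂ : ZpExtension K p) (θ : FramedGaloisRep K (padicCoeffIntegers (∅ : Set (PadicAlgCl p))) 1)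
  (θ' : absoluteGaloisGroup K →ₜ* ℤ_[p]ˣ) (𝔣 : Ideal (𝓞 K))
  [hFin : ∀ n : ℕ, Fintype (absoluteGaloisGroup K ⧸ pairLayerSubgroup κ₁ κ₂ n)]
  (h : poitouTate_shaRestricted_tateDual_natural_at K (suppPF p 𝔣))
  (hθ : ∀ σ : absoluteGaloisGroup K, ((θ' σ : ℤ_[p]ˣ) : ℤ_[p]) * ((unitChar θ σ : ℤ_[p]ˣ) : ℤ_[p]) = 1)
  (hV : ∀ n : ℕ, ramificationSubgroup K (suppPF p 𝔣) ≤ pairLayerSubgroup κ₁ κ₂ n)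
  (hμ : ∀ k : ℕ, ramificationSubgroup K (suppPF p 𝔣) ≤ ContinuousRep.ker (muTwist p θ' k))
  (hZ : ∀ k : ℕ, ramificationSubgroup K (suppPF p 𝔣) ≤ ContinuousRep.ker (zmodTwist p (unitChar θ) k))

/-! ## §1 Identifying `e⁻¹` of a structure-mapped class -/

/-- **`e₂⁻¹ w = c` as soon as the transported `c` is `w`** (injectivity of the Ш-condition transport and of the Shapiro
isomorphism, degree `2`). [cite: MilneADT2006, I §4 (p. 56)] -/
theorem coe_eTwo_symm_eq (n k : ℕ)
    (w : layerShaRestricted (suppPF p 𝔣) (muTwist p θ' k) (pairLayerSubgroup κ₁ κ₂ n) 2)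
    (c : restrictedCohomology ((muTwist p θ' k).coind (pairLayerSubgroup κ₁ κ₂ n) (isOpen_pairLayerSubgroup κ₁ κ₂ n))
      (suppPF p 𝔣) 2)
    (hc : haveI := finiteIndex_pairLayerSubgroup p κ₁ κ₂ n
      layerShapiroEquiv (suppPF p 𝔣) (muTwist p θ' k) (pairLayerSubgroup κ₁ κ₂ n) (isOpen_pairLayerSubgroup κ₁ κ₂ n) 2
        (restrictedCohomologyEquiv (suppPF p 𝔣) (muTwist p θ' k) (pairLayerSubgroup κ₁ κ₂ n)
          (isOpen_pairLayerSubgroup κ₁ κ₂ n) (hV n) (hμ k) 2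
          (c : restrictedCohomology ((muTwist p θ' k).coindOpen (pairLayerSubgroup κ₁ κ₂ n)
            (isOpen_pairLayerSubgroup κ₁ κ₂ n)) (suppPF p 𝔣) 2)) =
        (w : (continuousCohomology 2 (subgroupRep (((muTwist p θ' k).quotientInvariants
          (ramificationSubgroup K (suppPF p 𝔣))).toTopRep) ((pairLayerSubgroup κ₁ κ₂ n).map
            (toUnramifiedQuot K (suppPF p 𝔣)))) : Type))) :
    (((eTwo p κ₁ κ₂ θ' 𝔣 hV hμ n k).symm w :
        shaRestricted ((muTwist p θ' k).coind (pairLayerSubgroup κ₁ κ₂ n) (isOpen_pairLayerSubgroup κ₁ κ₂ n))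
          (suppPF p 𝔣) 2) :
      restrictedCohomology ((muTwist p θ' k).coind (pairLayerSubgroup κ₁ κ₂ n) (isOpen_pairLayerSubgroup κ₁ κ₂ n))
        (suppPF p 𝔣) 2) = c := by
  haveI := finiteIndex_pairLayerSubgroup p κ₁ κ₂ n
  apply (restrictedCohomologyEquiv (suppPF p 𝔣) (muTwist p θ' k) (pairLayerSubgroup κ₁ κ₂ n)
    (isOpen_pairLayerSubgroup κ₁ κ₂ n) (hV n) (hμ k) 2).injective
  apply (layerShapiroEquiv (suppPF p 𝔣) (muTwist p θ' k) (pairLayerSubgroup κ₁ κ₂ n)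
    (isOpen_pairLayerSubgroup κ₁ κ₂ n) 2).injective
  refine Eq.trans ?_ hc.symm
  change ((eTwo p κ₁ κ₂ θ' 𝔣 hV hμ n k ((eTwo p κ₁ κ₂ θ' 𝔣 hV hμ n k).symm w) :
      layerShaRestricted (suppPF p 𝔣) (muTwist p θ' k) (pairLayerSubgroup κ₁ κ₂ n) 2) : (continuousCohomology 2
        (subgroupRep (((muTwist p θ' k).quotientInvariants (ramificationSubgroup K (suppPF p 𝔣))).toTopRep)
          ((pairLayerSubgroup κ₁ κ₂ n).map (toUnramifiedQuot K (suppPF p 𝔣)))) : Type)) = _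
  rw [AddEquiv.apply_symm_apply]

/-- **`e₁⁻¹ w = c` as soon as the transported `c` is `w`** (degree `1`). [cite: MilneADT2006, I §4 (p. 56)] -/
theorem coe_eOne_symm_eq (n k : ℕ) (w : shaOne p κ₁ κ₂ θ 𝔣 n k)
    (c : restrictedCohomology ((zmodTwist p (unitChar θ) k).coind (pairLayerSubgroup κ₁ κ₂ n)
      (isOpen_pairLayerSubgroup κ₁ κ₂ n)) (suppPF p 𝔣) 1)
    (hc : haveI := finiteIndex_pairLayerSubgroup p κ₁ κ₂ n
      layerShapiroEquiv (suppPF p 𝔣) (zmodTwist p (unitChar θ) k) (pairLayerSubgroup κ₁ κ₂ n)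
          (isOpen_pairLayerSubgroup κ₁ κ₂ n) 1
        (restrictedCohomologyEquiv (suppPF p 𝔣) (zmodTwist p (unitChar θ) k) (pairLayerSubgroup κ₁ κ₂ n)
          (isOpen_pairLayerSubgroup κ₁ κ₂ n) (hV n) (hZ k) 1
          (c : restrictedCohomology ((zmodTwist p (unitChar θ) k).coindOpen (pairLayerSubgroup κ₁ κ₂ n)
            (isOpen_pairLayerSubgroup κ₁ κ₂ n)) (suppPF p 𝔣) 1)) =
        (w : (continuousCohomology 1 (subgroupRep (((zmodTwist p (unitChar θ) k).quotientInvariants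
          (ramificationSubgroup K (suppPF p 𝔣))).toTopRep) ((pairLayerSubgroup κ₁ κ₂ n).map
            (toUnramifiedQuot K (suppPF p 𝔣)))) : Type))) :
    (((eOne p κ₁ κ₂ θ 𝔣 hV hZ n k).symm w :
        shaRestricted ((zmodTwist p (unitChar θ) k).coind (pairLayerSubgroup κ₁ κ₂ n) (isOpen_pairLayerSubgroup κ₁ κ₂ n))
          (suppPF p 𝔣) 1) :
      restrictedCohomology ((zmodTwist p (unitChar θ) k).coind (pairLayerSubgroup κ₁ κ₂ n)
        (isOpen_pairLayerSubgroup κ₁ κ₂ n)) (suppPF p 𝔣) 1) = c := by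
  haveI := finiteIndex_pairLayerSubgroup p κ₁ κ₂ n
  apply (restrictedCohomologyEquiv (suppPF p 𝔣) (zmodTwist p (unitChar θ) k) (pairLayerSubgroup κ₁ κ₂ n)
    (isOpen_pairLayerSubgroup κ₁ κ₂ n) (hV n) (hZ k) 1).injective
  apply (layerShapiroEquiv (suppPF p 𝔣) (zmodTwist p (unitChar θ) k) (pairLayerSubgroup κ₁ κ₂ n)
    (isOpen_pairLayerSubgroup κ₁ κ₂ n) 1).injective
  refine Eq.trans ?_ hc.symm
  change ((eOne p κ₁ κ₂ θ 𝔣 hV hZ n k ((eOne p κ₁ κ₂ θ 𝔣 hV hZ n k).symm w) : shaOne p κ₁ κ₂ θ 𝔣 n k) :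
      (continuousCohomology 1 (subgroupRep (((zmodTwist p (unitChar θ) k).quotientInvariants
        (ramificationSubgroup K (suppPF p 𝔣))).toTopRep) ((pairLayerSubgroup κ₁ κ₂ n).map
          (toUnramifiedQuot K (suppPF p 𝔣)))) : Type)) = _
  rw [AddEquiv.apply_symm_apply]

include hV hμ in
/-- `Ind_{V_n}(μ_{p^k} ⊗ θ′)` is unramified outside `S = supp(p𝔣)`. [cite: MilneADT2006, I §4 (p. 56)] -/
theorem isUnramifiedOutside_mu_coind (n k : ℕ) :
    GaloisRep.IsUnramifiedOutside (suppPF p 𝔣)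
      ((muTwist p θ' k).coind (pairLayerSubgroup κ₁ κ₂ n) (isOpen_pairLayerSubgroup κ₁ κ₂ n)) := by
  haveI := finiteIndex_pairLayerSubgroup p κ₁ κ₂ n
  exact isUnramifiedOutside_coindOpen (suppPF p 𝔣) (muTwist p θ' k) (pairLayerSubgroup κ₁ κ₂ n)
    (isOpen_pairLayerSubgroup κ₁ κ₂ n) (hV n) (hμ k)

/-- The transported class of `e₂⁻¹ w` is `w`. [cite: MilneADT2006, I §4 (p. 56)] -/
theorem transport_eTwo_symm (n k : ℕ)
    (w : layerShaRestricted (suppPF p 𝔣) (muTwist p θ' k) (pairLayerSubgroup κ₁ κ₂ n) 2) :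
    haveI := finiteIndex_pairLayerSubgroup p κ₁ κ₂ n
    layerShapiroEquiv (suppPF p 𝔣) (muTwist p θ' k) (pairLayerSubgroup κ₁ κ₂ n) (isOpen_pairLayerSubgroup κ₁ κ₂ n) 2
        (restrictedCohomologyEquiv (suppPF p 𝔣) (muTwist p θ' k) (pairLayerSubgroup κ₁ κ₂ n)
          (isOpen_pairLayerSubgroup κ₁ κ₂ n) (hV n) (hμ k) 2
          ((((eTwo p κ₁ κ₂ θ' 𝔣 hV hμ n k).symm w :
              restrictedCohomology ((muTwist p θ' k).coind (pairLayerSubgroup κ₁ κ₂ n)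
                (isOpen_pairLayerSubgroup κ₁ κ₂ n)) (suppPF p 𝔣) 2) :
            restrictedCohomology ((muTwist p θ' k).coindOpen (pairLayerSubgroup κ₁ κ₂ n)
              (isOpen_pairLayerSubgroup κ₁ κ₂ n)) (suppPF p 𝔣) 2))) =
      (w : (continuousCohomology 2 (subgroupRep (((muTwist p θ' k).quotientInvariants
        (ramificationSubgroup K (suppPF p 𝔣))).toTopRep) ((pairLayerSubgroup κ₁ κ₂ n).map
          (toUnramifiedQuot K (suppPF p 𝔣)))) : Type)) := by
  change ((eTwo p κ₁ κ₂ θ' 𝔣 hV hμ n k ((eTwo p κ₁ κ₂ θ' 𝔣 hV hμ n k).symm w) :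
      layerShaRestricted (suppPF p 𝔣) (muTwist p θ' k) (pairLayerSubgroup κ₁ κ₂ n) 2) : (continuousCohomology 2
        (subgroupRep (((muTwist p θ' k).quotientInvariants (ramificationSubgroup K (suppPF p 𝔣))).toTopRep)
          ((pairLayerSubgroup κ₁ κ₂ n).map (toUnramifiedQuot K (suppPF p 𝔣)))) : Type)) = _
  rw [AddEquiv.apply_symm_apply]

/-- The transported class of `e₁⁻¹ w` is `w`. [cite: MilneADT2006, I §4 (p. 56)] -/
theorem transport_eOne_symm (n k : ℕ) (w : shaOne p κ₁ κ₂ θ 𝔣 n k) :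
    haveI := finiteIndex_pairLayerSubgroup p κ₁ κ₂ n
    layerShapiroEquiv (suppPF p 𝔣) (zmodTwist p (unitChar θ) k) (pairLayerSubgroup κ₁ κ₂ n)
        (isOpen_pairLayerSubgroup κ₁ κ₂ n) 1
        (restrictedCohomologyEquiv (suppPF p 𝔣) (zmodTwist p (unitChar θ) k) (pairLayerSubgroup κ₁ κ₂ n)
          (isOpen_pairLayerSubgroup κ₁ κ₂ n) (hV n) (hZ k) 1
          ((((eOne p κ₁ κ₂ θ 𝔣 hV hZ n k).symm w :
              restrictedCohomology ((zmodTwist p (unitChar θ) k).coind (pairLayerSubgroup κ₁ κ₂ n)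
                (isOpen_pairLayerSubgroup κ₁ κ₂ n)) (suppPF p 𝔣) 1) :
            restrictedCohomology ((zmodTwist p (unitChar θ) k).coindOpen (pairLayerSubgroup κ₁ κ₂ n)
              (isOpen_pairLayerSubgroup κ₁ κ₂ n)) (suppPF p 𝔣) 1))) =
      (w : (continuousCohomology 1 (subgroupRep (((zmodTwist p (unitChar θ) k).quotientInvariants
        (ramificationSubgroup K (suppPF p 𝔣))).toTopRep) ((pairLayerSubgroup κ₁ κ₂ n).map
          (toUnramifiedQuot K (suppPF p 𝔣)))) : Type)) := by
  change ((eOne p κ₁ κ₂ θ 𝔣 hV hZ n k ((eOne p κ₁ κ₂ θ 𝔣 hV hZ n k).symm w) : shaOne p κ₁ κ₂ θ 𝔣 n k) :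
      (continuousCohomology 1 (subgroupRep (((zmodTwist p (unitChar θ) k).quotientInvariants
        (ramificationSubgroup K (suppPF p 𝔣))).toTopRep) ((pairLayerSubgroup κ₁ κ₂ n).map
          (toUnramifiedQuot K (suppPF p 𝔣)))) : Type)) = _
  rw [AddEquiv.apply_symm_apply]

/-! ## §2 Corestriction ⊣ restriction -/

set_option maxHeartbeats 1600000 in
/-- **`⟨cor_{K̃_{n+1}/K̃_n} y, z⟩_n = ⟨y, res_{K̃_{n+1}/K̃_n} z⟩_{n+1}`** — the field `pair_cores` of the socket: clause (N_V) at
the adjoint pair (fibre sum `coindFinSum`, pull-back `coindFinRes`) (`sum_pairing_coindFinRes_eq_sum_coindFinSum`), transported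
by (S-cor) on `H²` (`transport_coindFinSum_eq_relCores`) and (S-res) on `H¹` (`layerShapiroEquiv_transport_coindFinRes`).
[cite: MilneADT2006, I §4 p. 65] [cite: JohnsonLeungKings2011, §5.4 Lemma 5.8 (arXiv p0015:L150–165)]
[cite: NeukirchSchmidtWingberg2008, I §5 Prop. (1.5.3)(iv)] -/
theorem pair_cores (n k : ℕ) (y : layerCoh p κ₁ κ₂ θ' 𝔣 (n + 1) k 2)
    (hy : y ∈ layerShaRestricted (suppPF p 𝔣) (muTwist p θ' k) (pairLayerSubgroup κ₁ κ₂ (n + 1)) 2)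
    (z : shaOne p κ₁ κ₂ θ 𝔣 n k) :
    pair p κ₁ κ₂ θ θ' 𝔣 h hθ hV hμ hZ n k
        ⟨layerCores p κ₁ κ₂ θ' 𝔣 n k 2 y, layerCores_mem_layerShaRestricted p κ₁ κ₂ θ' 𝔣 hV hμ n k hy⟩ z =
      pair p κ₁ κ₂ θ θ' 𝔣 h hθ hV hμ hZ (n + 1) k ⟨y, hy⟩ (resY p κ₁ κ₂ θ 𝔣 hV hZ n k z) := by
  haveI := finiteIndex_pairLayerSubgroup p κ₁ κ₂ n
  haveI := finiteIndex_pairLayerSubgroup p κ₁ κ₂ (n + 1)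
  haveI : NeZero (p ^ k) := ⟨pow_ne_zero k (Fact.out : p.Prime).ne_zero⟩
  have h' : pairLayerSubgroup κ₁ κ₂ (n + 1) ≤ pairLayerSubgroup κ₁ κ₂ n := pairLayerSubgroup_antitone κ₁ κ₂ (Nat.le_succ n)
  rw [pair_apply, pair_apply]
  refine (Classical.choose_spec (exists_shaRestricted_pairing_coind_of_natural_at (suppPF p 𝔣) h)).2
    (p ^ k) (MuCarrier K (p ^ k)) (ZMod (p ^ k)) (muTwist p θ' k) (zmodTwist p (unitChar θ) k) (muZModPairing K p k)
    (muZModPairing_equivariant K p k (unitChar θ) θ' hθ) (pairLayerSubgroup κ₁ κ₂ (n + 1))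
    (isOpen_pairLayerSubgroup κ₁ κ₂ (n + 1))
    (p ^ k) (MuCarrier K (p ^ k)) (ZMod (p ^ k)) (muTwist p θ' k) (zmodTwist p (unitChar θ) k) (muZModPairing K p k)
    (muZModPairing_equivariant K p k (unitChar θ) θ' hθ) (pairLayerSubgroup κ₁ κ₂ n) (isOpen_pairLayerSubgroup κ₁ κ₂ n)
    (bijective_muZModPairing_flip K p k) (mu_torsion p k) (isUnramifiedOutside_mu_coind p κ₁ κ₂ θ' 𝔣 hV hμ (n + 1) k)
    (natCard_mu_mem p 𝔣 k) (mu_torsion p k) (isUnramifiedOutside_mu_coind p κ₁ κ₂ θ' 𝔣 hV hμ n k) (natCard_mu_mem p 𝔣 k)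
    (coindFinSum (muTwist p θ' k).toTopRep h') (coindFinRes (zmodTwist p (unitChar θ) k).toTopRep h') ?_
    ((eTwo p κ₁ κ₂ θ' 𝔣 hV hμ (n + 1) k).symm ⟨y, hy⟩)
    ((eTwo p κ₁ κ₂ θ' 𝔣 hV hμ n k).symm
      ⟨layerCores p κ₁ κ₂ θ' 𝔣 n k 2 y, layerCores_mem_layerShaRestricted p κ₁ κ₂ θ' 𝔣 hV hμ n k hy⟩) ?_
    ((eOne p κ₁ κ₂ θ 𝔣 hV hZ n k).symm z)
    ((eOne p κ₁ κ₂ θ 𝔣 hV hZ (n + 1) k).symm (resY p κ₁ κ₂ θ 𝔣 hV hZ n k z)) ?_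
  · -- (hadj) trace ⊣ pull-back for the summed pairing
    intro φ ψ
    classical
    refine congrArg (fun s : MuCarrier K (p ^ k) =>
      ((Additive.toMul s : rootsOfUnity (p ^ k) (AlgebraicClosure K)) : (AlgebraicClosure K)ˣ)) ?_
    exact sum_pairing_coindFinRes_eq_sum_coindFinSum h' (muZModPairing K p k) φ ψ
  · -- (x) `e₂⁻¹ (cor y) = Σ_* (e₂⁻¹ y)`: (S-cor)
    refine coe_eTwo_symm_eq p κ₁ κ₂ θ' 𝔣 hV hμ n k _ _ ?_
    haveI : ((pairLayerSubgroup κ₁ κ₂ (n + 1)).map (toUnramifiedQuot K (suppPF p 𝔣))).FiniteIndex :=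
      finiteIndex_imGS' (suppPF p 𝔣) (isOpen_pairLayerSubgroup κ₁ κ₂ (n + 1))
    letI : Fintype (GaloisGroupUnramifiedOutside K (suppPF p 𝔣) ⧸ (pairLayerSubgroup κ₁ κ₂ (n + 1)).map
        (toUnramifiedQuot K (suppPF p 𝔣))) := Fintype.ofFinite _
    refine (transport_coindFinSum_eq_relCores p (suppPF p 𝔣) θ' (isOpen_pairLayerSubgroup κ₁ κ₂ n)
      (isOpen_pairLayerSubgroup κ₁ κ₂ (n + 1)) h' (hV n) (hV (n + 1)) k (hμ k) 2 _).trans ?_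
    rw [transport_eTwo_symm]
    rfl
  · -- (z) `e₁⁻¹ (res z) = π^* (e₁⁻¹ z)`: (S-res)
    refine coe_eOne_symm_eq p κ₁ κ₂ θ 𝔣 hV hZ (n + 1) k _ _ ?_
    refine (layerShapiroEquiv_transport_coindFinRes (suppPF p 𝔣) (zmodTwist p (unitChar θ) k)
      (pairLayerSubgroup κ₁ κ₂ n) (pairLayerSubgroup κ₁ κ₂ (n + 1)) (isOpen_pairLayerSubgroup κ₁ κ₂ n)
      (isOpen_pairLayerSubgroup κ₁ κ₂ (n + 1)) h' (hV n) (hV (n + 1)) (hZ k) 1 _).trans ?_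
    rw [transport_eOne_symm]
    exact (coe_resY p κ₁ κ₂ θ 𝔣 hV hZ n k z).symm

/-! ## §3 Reduction ⊣ inclusion -/

set_option maxHeartbeats 1600000 in
/-- **`⟨red y, z⟩_k = ⟨y, incl z⟩_{k+1}`** — the field `pair_red` of the socket: clause (N_V) at the adjoint pair
(`ζ ↦ ζ^p` = `coindFinMap muTwistPowHom`, `a ↦ p·a` = `coindFinMap zmodInclHom`) (`muVal_sum_muZModPairing_muPowMap`),
transported by (S-coeff) (`transport_coindFinMap_eq_levelRed`, `layerShapiroEquiv_transport_coindFinMap`).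
[cite: MilneADT2006, I §4 p. 65] [cite: Kato2004Asterisque, §8.2 (p. 180)] [cite: JohnsonLeungKings2011, §5.4 Lemma 5.8 (arXiv p0015:L150–165)] -/
theorem pair_red (n k : ℕ) (y : layerCoh p κ₁ κ₂ θ' 𝔣 n (k + 1) 2)
    (hy : y ∈ layerShaRestricted (suppPF p 𝔣) (muTwist p θ' (k + 1)) (pairLayerSubgroup κ₁ κ₂ n) 2)
    (z : shaOne p κ₁ κ₂ θ 𝔣 n k) :
    pair p κ₁ κ₂ θ θ' 𝔣 h hθ hV hμ hZ n k
        ⟨layerRed p κ₁ κ₂ θ' 𝔣 n k 2 y, layerRed_mem_layerShaRestricted p κ₁ κ₂ θ' 𝔣 hV hμ n k hy⟩ z =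
      pair p κ₁ κ₂ θ θ' 𝔣 h hθ hV hμ hZ n (k + 1) ⟨y, hy⟩ (inclY p κ₁ κ₂ θ 𝔣 hV hZ n k z) := by
  haveI := finiteIndex_pairLayerSubgroup p κ₁ κ₂ n
  haveI : NeZero (p ^ k) := ⟨pow_ne_zero k (Fact.out : p.Prime).ne_zero⟩
  haveI : NeZero (p ^ (k + 1)) := ⟨pow_ne_zero (k + 1) (Fact.out : p.Prime).ne_zero⟩
  rw [pair_apply, pair_apply]
  refine (Classical.choose_spec (exists_shaRestricted_pairing_coind_of_natural_at (suppPF p 𝔣) h)).2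
    (p ^ (k + 1)) (MuCarrier K (p ^ (k + 1))) (ZMod (p ^ (k + 1))) (muTwist p θ' (k + 1))
    (zmodTwist p (unitChar θ) (k + 1)) (muZModPairing K p (k + 1))
    (muZModPairing_equivariant K p (k + 1) (unitChar θ) θ' hθ) (pairLayerSubgroup κ₁ κ₂ n)
    (isOpen_pairLayerSubgroup κ₁ κ₂ n)
    (p ^ k) (MuCarrier K (p ^ k)) (ZMod (p ^ k)) (muTwist p θ' k) (zmodTwist p (unitChar θ) k) (muZModPairing K p k)
    (muZModPairing_equivariant K p k (unitChar θ) θ' hθ) (pairLayerSubgroup κ₁ κ₂ n) (isOpen_pairLayerSubgroup κ₁ κ₂ n)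
    (bijective_muZModPairing_flip K p k) (mu_torsion p (k + 1))
    (isUnramifiedOutside_mu_coind p κ₁ κ₂ θ' 𝔣 hV hμ n (k + 1)) (natCard_mu_mem p 𝔣 (k + 1)) (mu_torsion p k)
    (isUnramifiedOutside_mu_coind p κ₁ κ₂ θ' 𝔣 hV hμ n k) (natCard_mu_mem p 𝔣 k)
    (coindFinMap (muTwistPowHom p θ' k) (pairLayerSubgroup κ₁ κ₂ n))
    (coindFinMap (zmodInclHom p (unitChar θ) k) (pairLayerSubgroup κ₁ κ₂ n)) ?_
    ((eTwo p κ₁ κ₂ θ' 𝔣 hV hμ n (k + 1)).symm ⟨y, hy⟩)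
    ((eTwo p κ₁ κ₂ θ' 𝔣 hV hμ n k).symm
      ⟨layerRed p κ₁ κ₂ θ' 𝔣 n k 2 y, layerRed_mem_layerShaRestricted p κ₁ κ₂ θ' 𝔣 hV hμ n k hy⟩) ?_
    ((eOne p κ₁ κ₂ θ 𝔣 hV hZ n k).symm z)
    ((eOne p κ₁ κ₂ θ 𝔣 hV hZ n (k + 1)).symm (inclY p κ₁ κ₂ θ 𝔣 hV hZ n k z)) ?_
  · -- (hadj) `ζ ↦ ζ^p` ⊣ `a ↦ p·a`, in `K̄ˣ`
    intro φ ψ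
    exact (muVal_sum_muZModPairing_muPowMap K p k φ ψ).symm
  · -- (x) `e₂⁻¹ (red y) = (ζ ↦ ζ^p)_* (e₂⁻¹ y)`: (S-coeff) on `H²`
    refine coe_eTwo_symm_eq p κ₁ κ₂ θ' 𝔣 hV hμ n k _ _ ?_
    refine (transport_coindFinMap_eq_levelRed p (suppPF p 𝔣) θ' (isOpen_pairLayerSubgroup κ₁ κ₂ n) (hV n) k
      (hμ (k + 1)) (hμ k) (muTwistPowHom p θ' k) (muTwistPowHom_apply p θ' k) 2 _).trans ?_
    rw [transport_eTwo_symm]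
    rfl
  · -- (z) `e₁⁻¹ (incl z) = (a ↦ p·a)_* (e₁⁻¹ z)`: (S-coeff) on `H¹`
    refine coe_eOne_symm_eq p κ₁ κ₂ θ 𝔣 hV hZ n (k + 1) _ _ ?_
    refine (layerShapiroEquiv_transport_coindFinMap (suppPF p 𝔣) (zmodTwist p (unitChar θ) k)
      (zmodTwist p (unitChar θ) (k + 1)) (pairLayerSubgroup κ₁ κ₂ n) (isOpen_pairLayerSubgroup κ₁ κ₂ n) (hV n) (hZ k)
      (hZ (k + 1)) (zmodInclHom p (unitChar θ) k) 1 _).trans ?_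
    rw [transport_eOne_symm]
    exact (coe_inclY p κ₁ κ₂ θ 𝔣 hV hZ n k z).symm

/-! ## §4 `conj_γ ⊣ conj_{γ⁻¹}` -/

set_option maxHeartbeats 1600000 in
/-- **`⟨conj_γ y, z⟩ = ⟨y, conj_{γ⁻¹} z⟩`** — the field `pair_conj` of the socket: clause (N_V) at the adjoint pair of right
translations (`R_{γV} ⊣ R_{γ⁻¹V}`, `sum_pairing_rTrans`), transported by (S-conj) (`transport_rTransHom_eq_levelConj_two`,
`layerShapiroEquiv_transport_rTransHom_one`). [cite: MilneADT2006, I §4 p. 65] [cite: SerreLocalFields1979, VII §5]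
[cite: JohnsonLeungKings2011, §4.2 (arXiv p0012:L109–112), §5.4 Lemma 5.8] -/
theorem pair_conj (n k : ℕ) (γ : absoluteGaloisGroup K) (y : layerCoh p κ₁ κ₂ θ' 𝔣 n k 2)
    (hy : y ∈ layerShaRestricted (suppPF p 𝔣) (muTwist p θ' k) (pairLayerSubgroup κ₁ κ₂ n) 2)
    (z : shaOne p κ₁ κ₂ θ 𝔣 n k) :
    pair p κ₁ κ₂ θ θ' 𝔣 h hθ hV hμ hZ n k
        ⟨layerConj p κ₁ κ₂ θ' 𝔣 n k 2 γ y, layerConj_mem_layerShaRestricted p κ₁ κ₂ θ' 𝔣 n k γ hy⟩ z =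
      pair p κ₁ κ₂ θ θ' 𝔣 h hθ hV hμ hZ n k ⟨y, hy⟩ (conjY p κ₁ κ₂ θ 𝔣 n k γ⁻¹ z) := by
  haveI := finiteIndex_pairLayerSubgroup p κ₁ κ₂ n
  haveI : NeZero (p ^ k) := ⟨pow_ne_zero k (Fact.out : p.Prime).ne_zero⟩
  rw [pair_apply, pair_apply]
  refine (Classical.choose_spec (exists_shaRestricted_pairing_coind_of_natural_at (suppPF p 𝔣) h)).2
    (p ^ k) (MuCarrier K (p ^ k)) (ZMod (p ^ k)) (muTwist p θ' k) (zmodTwist p (unitChar θ) k) (muZModPairing K p k)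
    (muZModPairing_equivariant K p k (unitChar θ) θ' hθ) (pairLayerSubgroup κ₁ κ₂ n) (isOpen_pairLayerSubgroup κ₁ κ₂ n)
    (p ^ k) (MuCarrier K (p ^ k)) (ZMod (p ^ k)) (muTwist p θ' k) (zmodTwist p (unitChar θ) k) (muZModPairing K p k)
    (muZModPairing_equivariant K p k (unitChar θ) θ' hθ) (pairLayerSubgroup κ₁ κ₂ n) (isOpen_pairLayerSubgroup κ₁ κ₂ n)
    (bijective_muZModPairing_flip K p k) (mu_torsion p k) (isUnramifiedOutside_mu_coind p κ₁ κ₂ θ' 𝔣 hV hμ n k)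
    (natCard_mu_mem p 𝔣 k) (mu_torsion p k) (isUnramifiedOutside_mu_coind p κ₁ κ₂ θ' 𝔣 hV hμ n k) (natCard_mu_mem p 𝔣 k)
    ((muTwist p θ' k).coindOpenRTrans (pairLayerSubgroup κ₁ κ₂ n) (isOpen_pairLayerSubgroup κ₁ κ₂ n)
      (QuotientGroup.mk γ : absoluteGaloisGroup K ⧸ pairLayerSubgroup κ₁ κ₂ n))
    ((zmodTwist p (unitChar θ) k).coindOpenRTrans (pairLayerSubgroup κ₁ κ₂ n) (isOpen_pairLayerSubgroup κ₁ κ₂ n)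
      (QuotientGroup.mk γ⁻¹ : absoluteGaloisGroup K ⧸ pairLayerSubgroup κ₁ κ₂ n)) ?_
    ((eTwo p κ₁ κ₂ θ' 𝔣 hV hμ n k).symm ⟨y, hy⟩)
    ((eTwo p κ₁ κ₂ θ' 𝔣 hV hμ n k).symm
      ⟨layerConj p κ₁ κ₂ θ' 𝔣 n k 2 γ y, layerConj_mem_layerShaRestricted p κ₁ κ₂ θ' 𝔣 n k γ hy⟩) ?_
    ((eOne p κ₁ κ₂ θ 𝔣 hV hZ n k).symm z)
    ((eOne p κ₁ κ₂ θ 𝔣 hV hZ n k).symm (conjY p κ₁ κ₂ θ 𝔣 n k γ⁻¹ z)) ?_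
  · -- (hadj) `R_{γV}` ⊣ `R_{γ⁻¹V}`
    intro φ ψ
    refine congrArg (fun s : MuCarrier K (p ^ k) =>
      ((Additive.toMul s : rootsOfUnity (p ^ k) (AlgebraicClosure K)) : (AlgebraicClosure K)ˣ)) ?_
    rw [QuotientGroup.mk_inv]
    exact (sum_pairing_rTrans (muZModPairing K p k)
      (QuotientGroup.mk γ : absoluteGaloisGroup K ⧸ pairLayerSubgroup κ₁ κ₂ n) φ ψ).symm
  · -- (x) `e₂⁻¹ (conj_γ y) = R_{γV,*} (e₂⁻¹ y)`: (S-conj) on `H²`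
    refine coe_eTwo_symm_eq p κ₁ κ₂ θ' 𝔣 hV hμ n k _ _ ?_
    refine (transport_rTransHom_eq_levelConj_two p (suppPF p 𝔣) θ' (isOpen_pairLayerSubgroup κ₁ κ₂ n) (hV n) k
      (hμ k) γ _).trans ?_
    rw [transport_eTwo_symm]
    rfl
  · -- (z) `e₁⁻¹ (conj_{γ⁻¹} z) = R_{γ⁻¹V,*} (e₁⁻¹ z)`: (S-conj) on `H¹`
    refine coe_eOne_symm_eq p κ₁ κ₂ θ 𝔣 hV hZ n k _ _ ?_
    refine (layerShapiroEquiv_transport_rTransHom_one (suppPF p 𝔣) (zmodTwist p (unitChar θ) k)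
      (pairLayerSubgroup κ₁ κ₂ n) (isOpen_pairLayerSubgroup κ₁ κ₂ n) (hV n) (hZ k) γ⁻¹ _).trans ?_
    rw [transport_eOne_symm]
    exact (coe_conjY p κ₁ κ₂ θ 𝔣 n k γ⁻¹ z).symm

end Literature.NumberTheory.ComplexMultiplication.EllipticUnits.JohnsonLeungKings2011.ClassGroupRow

end
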